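import Summits.ResolutionOfSingularities.ResolutionOfSingularities.Theorems.FrobeniusClosingPatchingRelPerfectDepthGradedCharts
import Literature.AlgebraicGeometry.Motives.FormsEmbedding
import Literature.AlgebraicGeometry.Resolution.BlowupsScaling
import Literature.AlgebraicGeometry.Resolution.BlowupsComposition
import Literature.AlgebraicGeometry.Limits.FiniteTypeModel
import HarnessLib

/-!
# Crux `PatchingRelPerfect` (stmt-ResolutionOfSingularities-16161), chain w52 — R4 X-side, graded initial
# state (D): the GRADED FORMAT of a form over the coefficient field on `X₁ = Bl_𝔪 Spec S`

[OURS · L1 W5.2 · rung tool] res-L1-w52-plan-1 g6 RATIFY 2026-08-27 «res-D-pv-055 (D) initial retraction +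
graded format for I = (F) + J over a COEFFICIENT FIELD — GO»; third file of (D) after
`…DepthGradedRetraction` (the retraction `r : X₁ → E`) and `…DepthGradedStructureMaps` (`r₀` is a
`κ₀`-morphism).  Setting: `y = (y₀, …, y_m)` in a ring `S`, `𝔪 = (y)`, `κ₀` a field with `κ₀ → S`,
`X₁ = Bl_𝔪 Spec S = Proj S[𝔪t]` (`affineBlowup`, `g = affineBlowup.π`), `r₀ : X₁ → ℙᵐ_{κ₀}` the composite
`Proj.map (T_j ↦ y_j t) ≫ Proj.map (κ₀ → S)`, and `F ∈ κ₀[T₀, …, T_m]` a FORM of degree `e`.  The section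
`F` of `r₀^*𝒪(e)` in chart form is the Motives library's `(GeneratingSections.ofHom r₀).secOfForm _ F`
and its zero scheme `𝔟̃ ⊆ 𝒪_{X₁}` is `Sec.zeroIdeal` (the scheme-theoretic pull-back of `V₊(F) ⊂ ℙᵐ_{κ₀}`).
PROVED, chart by chart on the cover `D₊(y_i t) = Spec (S[𝔪t]_{y_i t})₀` (fact-free):

* (chart calculus: `…DepthGradedCharts.lean`);
* `comap_awayι_zeroIdeal` — **on the chart, `𝔟̃` is the principal ideal sheaf of `F(y)tᵉ/(y_i t)ᵉ`**
  (Motives `Sec.ideal_zeroIdeal_self` + `sectionsFun_ofHom_eq_app`);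
* `eq_of_forall_comap_awayι_eq` — ideal sheaves on `X₁` agreeing on every chart are equal;
* `comap_idealSheaf_span_aeval_eq` — **THE GRADED FORMAT: `(F(y))𝒪_{X₁} = 𝓘_Eᵉ · 𝔟̃`;**
* `zeroIdeal_comap_eq_of_comp_eq` — **CONICITY: `π^*𝔟̃ = 𝔟̃` for every endomorphism `π` of `X₁` over
  `ℙᵐ_{κ₀}`** (e.g. `π = r ≫ i` for the retraction, whence `𝔟̃ = r^*(𝔟̃|_E)`).

With `…DepthGradedRetraction` (`𝔟̃|_E` pulled back along `r`) this is the weight-`e` layer of the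
format `I𝒪_{X₁} = 𝓘_Eᵉ · (r^*𝔟 ⊔ 𝓘_E^ℓ)` for `I = (F(y)) + J`; the package is the next file.  The standard gradings `MvPolynomial.gradedAlgebra` are switched on locally
(as in the Literature files this builds on).  Nothing here is a statement of the manuscript under review.

## References

* R. Hartshorne, *Algebraic Geometry* (1977), II Thm. 7.1 (a), Prop. 7.2. [Hartshorne1977]
* U. Görtz, T. Wedhorn, *Algebraic Geometry I*, 2nd ed. (2020), Remark 11.27, (13.13), Def. 13.90.
  [GortzWedhorn2020]
-/

-- `Summit.<Summit>.<Sub>.Theorems` with `Sub = Summit` (single-conjunct summit, D-0017)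

set_option linter.dupNamespace false

noncomputable section

open CategoryTheory CategoryTheory.Limits AlgebraicGeometry Literature.AlgebraicGeometry.Resolution
open IsLocalRing TopologicalSpace HomogeneousLocalization
open Literature.AlgebraicGeometry.Motives Literature.AlgebraicGeometry.Motives.ProjBaseChangeRing

-- The standard gradings of polynomial rings are `def`s in Mathlib; as in the Literature files
-- `Resolution/ExceptionalDivisorProjCharts`, `Motives/ProjBaseChangeAny` they are switched on locally.
attribute [local instance] MvPolynomial.gradedAlgebra

namespace Summit.ResolutionOfSingularities.ResolutionOfSingularities.Theorems

namespace DepthOne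

universe u

section Chart

variable {S : Type u} [CommRing S] {m : ℕ} (y : Fin (m + 1) → S)
  (κ₀ : Type u) [Field κ₀] [Algebra κ₀ S]

local notation3 "M" => Ideal.span (Set.range y)
local notation3 "ℛ" => reesGrading (Ideal.span (Set.range y))
local notation3 "X₁" => affineBlowup (Ideal.span (Set.range y))
local notation3 "g" => affineBlowup.π (Ideal.span (Set.range y))
local notation3 "𝒜κ" => MvPolynomial.homogeneousSubmodule (Fin (m + 1)) κ₀
/-- the chart element `y_i t ∈ S[𝔪t]`, spelled as the image of `T_i` under the graded presentation
composed with the base change (so that Mathlib's `Proj.map` chart lemmas apply verbatim) -/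
local notation3 "sElt" => fun (i : Fin (m + 1)) =>
  (reesPresentation y) ((mapGraded κ₀ S (Fin (m + 1))) (MvPolynomial.X i))

/-- `r₀` written out (as in `…DepthGradedRetraction`). -/
local notation3 "R₀" => (Proj.map (reesPresentation y) (irrelevant_le_map_reesPresentation y) ≫
  Proj.map (mapGraded κ₀ S (Fin (m + 1))) (irrelevant_le_map κ₀ S (Fin (m + 1))) :
    affineBlowup (Ideal.span (Set.range y)) ⟶ ProjSpace.P m κ₀)

/-! ### The zero ideal of the pulled-back form on the chart -/

/-- the `κ₀`-structure of `X₁` -/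
local notation3 "F₀" => (affineBlowup.π (Ideal.span (Set.range y)) ≫
  Spec.map (CommRingCat.ofHom (algebraMap κ₀ S)) : affineBlowup (Ideal.span (Set.range y)) ⟶ Spec (.of κ₀))

/-- `r₀` is a morphism over `Spec κ₀` in the spelling of the Motives library (`Segre.toSpec`).
[folklore] -/
theorem retraction₀_comp_toSpec : R₀ ≫ Segre.toSpec (Fin (m + 1)) κ₀ = F₀ :=
  retraction₀_comp_projToSpec y κ₀

/-- The charts `r₀⁻¹ D₊(T_j) = D₊(y_j t)` of the generating-sections data `ofHom r₀` are affine.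
[folklore] -/
theorem ofHom_retraction₀_U (j : Fin (m + 1)) :
    (GeneratingSections.ofHom (k := κ₀) R₀).U j = Proj.basicOpen ℛ (sElt j) := by
  rw [GeneratingSections.ofHom_U, Scheme.Hom.comp_preimage, Proj.map_preimage_basicOpen,
    Proj.map_preimage_basicOpen]

/-- The charts `r₀⁻¹ D₊(T_j) = D₊(y_j t)` of the generating-sections data `ofHom r₀` are affine.
[folklore] -/
theorem isAffineOpen_ofHom_retraction₀_U (j : Fin (m + 1)) :
    IsAffineOpen ((GeneratingSections.ofHom (k := κ₀) R₀).U j) := by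
  rw [ofHom_retraction₀_U]
  exact Proj.isAffineOpen_basicOpen ℛ (sElt j) (sElt_mem y κ₀ j) one_pos

set_option maxHeartbeats 800000 in
/-- **The zero scheme of the pulled-back form `F(y₀ t, …, y_m t)` on the chart `D₊(y_i t)`**: for a
form `F ∈ κ₀[T]` of degree `e`, the zero ideal (Motives `GeneratingSections.Sec.zeroIdeal`) of the
section `F` of `r₀^*𝒪(e)` pulls back to `Spec (S[𝔪t]_{y_i t})₀` as the principal ideal sheaf of
`F(y)tᵉ/(y_i t)ᵉ` (the dehomogenisation `F/T_iᵉ` pushed along the two `Away.map`s).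
[cite: GortzWedhorn2020, Remark 11.27 and (13.13)] [cite: Hartshorne1977, II Thm. 7.1 (a)] -/
theorem comap_awayι_zeroIdeal [IsNoetherianRing S] (i : Fin (m + 1)) {e : ℕ}
    (F : MvPolynomial (Fin (m + 1)) κ₀) (hF : F.IsHomogeneous e) :
    ((GeneratingSections.ofHom R₀).secOfForm F₀ F hF).zeroIdeal.comap
        (Proj.awayι ℛ (sElt i) (sElt_mem y κ₀ i) one_pos) =
      affineBlowup.idealSheaf (Ideal.span
        {Away.map (reesPresentation y) ((mapGraded κ₀ S (Fin (m + 1))) (MvPolynomial.X i))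
          (Away.map (mapGraded κ₀ S (Fin (m + 1))) (MvPolynomial.X i)
            (Away.isLocalizationElem (ProjectiveSpace.X_mem (R := κ₀) i) hF))}) := by
  haveI : IsNoetherian (affineBlowup (M)) := isNoetherian_of_isBlowup (affineBlowup.isBlowup (M))
  have hU := isAffineOpen_ofHom_retraction₀_U y κ₀
  have hval := ((GeneratingSections.ofHom R₀).secOfForm F₀ F hF).ideal_zeroIdeal_self hU i
  have hvi : ((GeneratingSections.ofHom R₀).secOfForm F₀ F hF).val i =
      (R₀).app (Proj.basicOpen 𝒜κ (MvPolynomial.X i)) (Proj.awayToSection 𝒜κ (MvPolynomial.X i)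
        (Away.isLocalizationElem (ProjectiveSpace.X_mem (R := κ₀) i) hF)) := by
    rw [GeneratingSections.secOfForm_val]
    exact GeneratingSections.sectionsFun_ofHom_eq_app (F₀) (R₀) (retraction₀_comp_toSpec y κ₀) i F hF
  have e : ((⊤ : (Spec (.of (Away ℛ (sElt i)))).Opens) : (Spec (.of (Away ℛ (sElt i)))).Opens) ≤
      Proj.awayι ℛ (sElt i) (sElt_mem y κ₀ i) one_pos ⁻¹ᵁ ((GeneratingSections.ofHom (k := κ₀) R₀).U i) := by
    rw [ofHom_retraction₀_U]
    exact top_le_preimage_of_opensRange_eq _ (Proj.opensRange_awayι ℛ (sElt i) (sElt_mem y κ₀ i) one_pos)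
  apply Scheme.IdealSheafData.ext_of_isAffine
  rw [ideal_comap_of_le (Proj.awayι ℛ (sElt i) (sElt_mem y κ₀ i) one_pos)
    ((GeneratingSections.ofHom R₀).secOfForm F₀ F hF).zeroIdeal ⟨_, hU i⟩ ⟨⊤, isAffineOpen_top _⟩ e, hval,
    Ideal.map_span,
    Set.image_singleton, hvi, affineBlowup.idealSheaf, ideal_ofIdealTop_top, Ideal.map_span, Set.image_singleton]
  congr 2
  -- `ι'^*(r₀^* x) = (ι' ≫ r₀)^* x = ΓSpecIso.inv (Away.map (Away.map …))`
  have happ := congrArg (fun ψ => ψ.hom (Proj.awayToSection 𝒜κ (MvPolynomial.X i)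
      (Away.isLocalizationElem (ProjectiveSpace.X_mem (R := κ₀) i) hF)))
    (Scheme.Hom.appLE_comp_appLE (Proj.awayι ℛ (sElt i) (sElt_mem y κ₀ i) one_pos) (R₀)
      (Proj.basicOpen 𝒜κ (MvPolynomial.X i)) ((GeneratingSections.ofHom (k := κ₀) R₀).U i) ⊤ le_rfl e)
  simp only [CommRingCat.hom_comp, RingHom.coe_comp, Function.comp_apply] at happ
  rw [Scheme.Hom.app_eq_appLE]
  exact happ.trans (appLE_awayι_retraction₀ y κ₀ i _ _)

/-! ### Gluing over the charts `D₊(y_i t)` -/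

/-- The charts `D₊(y_i t)` cover `X₁`. [folklore] -/
theorem iSup_basicOpen_sElt : ⨆ i, Proj.basicOpen ℛ (sElt i) = ⊤ := by
  have h := GeneratingSections.iSup_preU (k := κ₀) R₀
  have h' : ∀ i, GeneratingSections.preU (k := κ₀) R₀ i = Proj.basicOpen ℛ (sElt i) := fun i =>
    ofHom_retraction₀_U y κ₀ i
  simp only [h'] at h
  exact h

omit [Algebra κ₀ S] [Field κ₀] in
/-- The chart inclusion `D₊(s) ↪ X₁` is the chart isomorphism followed by `awayι`. [folklore] -/
theorem basicOpen_ι_eq (s : reesAlgebra (M)) {d : ℕ} (hs : s ∈ ℛ d) (hd : 0 < d) :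
    (Proj.basicOpen ℛ s).ι = (Proj.basicOpenIsoSpec ℛ s hs hd).hom ≫ Proj.awayι ℛ s hs hd :=
  ((Proj.basicOpenIsoSpec ℛ s hs hd).hom_inv_id_assoc _).symm

/-- **Ideal sheaves on `X₁` agreeing on every chart `Spec (S[𝔪t]_{y_i t})₀` are equal.** [folklore] -/
theorem eq_of_forall_comap_awayι_eq {K₁ K₂ : (affineBlowup (M)).IdealSheafData}
    (h : ∀ i, K₁.comap (Proj.awayι ℛ (sElt i) (sElt_mem y κ₀ i) one_pos) =
      K₂.comap (Proj.awayι ℛ (sElt i) (sElt_mem y κ₀ i) one_pos)) : K₁ = K₂ := by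
  have key : ∀ i, K₁.comap (Proj.basicOpen ℛ (sElt i)).ι = K₂.comap (Proj.basicOpen ℛ (sElt i)).ι := by
    intro i
    rw [basicOpen_ι_eq y (sElt i) (sElt_mem y κ₀ i) one_pos, Scheme.IdealSheafData.comap_comp,
      Scheme.IdealSheafData.comap_comp, h i]
  exact le_antisymm
    (le_of_forall_comap_ι_le (fun i => Proj.basicOpen ℛ (sElt i)) (iSup_basicOpen_sElt y κ₀)
      fun i => (key i).le)
    (le_of_forall_comap_ι_le (fun i => Proj.basicOpen ℛ (sElt i)) (iSup_basicOpen_sElt y κ₀)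
      fun i => (key i).ge)

/-! ### The graded FORMAT of a form over the coefficient field -/

/-- **GRADED FORMAT, weight-`e` part**: for a form `F ∈ κ₀[T₀, …, T_m]` of degree `e` over the
coefficient field, the ideal `(F(y))𝒪_{X₁}` is `𝓘_Eᵉ · 𝔟̃`, where `𝔟̃` is the zero scheme (Motives
`Sec.zeroIdeal`) of the section `F` of `r₀^*𝒪(e)` — i.e. of the pull-back of the hypersurface
`V₊(F) ⊂ ℙᵐ_{κ₀}` along `r₀`. Chart check: `F(y) = y_iᵉ · F(y)tᵉ/(y_i t)ᵉ` in `(S[𝔪t]_{y_i t})₀`.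
[cite: Hartshorne1977, II Thm. 7.1 (a)] [cite: GortzWedhorn2020, (13.13)] -/
theorem comap_idealSheaf_span_aeval_eq [IsNoetherianRing S] {e : ℕ} (F : MvPolynomial (Fin (m + 1)) κ₀)
    (hF : F.IsHomogeneous e) :
    (affineBlowup.idealSheaf (Ideal.span {MvPolynomial.aeval y F})).comap g =
      ((affineBlowup.idealSheaf (M)).comap g) ^ e *
        ((GeneratingSections.ofHom R₀).secOfForm F₀ F hF).zeroIdeal := by
  refine eq_of_forall_comap_awayι_eq y κ₀ fun i => ?_
  rw [comap_mul, comap_pow, comap_awayι_comap_π, comap_awayι_comap_π, comap_awayι_zeroIdeal,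
    ← idealSheaf_pow, ← affineBlowup.idealSheaf_mul, map_reesAwayBase_span_eq y (sElt i) (sElt_mem y κ₀ i) i
      (coe_sElt y κ₀ i), Ideal.span_singleton_pow, Ideal.span_singleton_mul_span_singleton,
    reesAwayBase_pow_mul_awayMap, Ideal.map_span, Set.image_singleton]

/-! ### Conicity: the zero scheme of the form is invariant under endomorphisms over `ℙᵐ_{κ₀}` -/

omit [Algebra κ₀ S] [Field κ₀] in
/-- `comap_idealSheaf_specMap` for a `CommRingCat` morphism. [folklore] -/
theorem comap_idealSheaf_specMap' {A B : Type u} [CommRing A] [CommRing B]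
    (φ : CommRingCat.of A ⟶ CommRingCat.of B) (J : Ideal A) :
    (affineBlowup.idealSheaf J).comap (Spec.map φ) = affineBlowup.idealSheaf (J.map φ.hom) :=
  comap_idealSheaf_specMap φ.hom J

set_option maxHeartbeats 800000 in
/-- **CONICITY of the zero scheme of a pulled-back form**: for every endomorphism `π` of `X₁` OVER
`ℙᵐ_{κ₀}` (`π ≫ r₀ = r₀`; e.g. `π = r ≫ i` for the retraction `r : X₁ → E`), the zero ideal `𝔟̃` of the
section `F` of `r₀^*𝒪(e)` satisfies `π^*𝔟̃ = 𝔟̃`.  Chartwise: `π` lifts to an endomorphism `θ` of the chart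
`Spec (S[𝔪t]_{y_i t})₀` over `D₊(T_i)`, which fixes the generator `F(y)tᵉ/(y_i t)ᵉ` (a pull-back from
`D₊(T_i)`). [cite: GortzWedhorn2020, Def. 13.90, (13.13)] -/
theorem zeroIdeal_comap_eq_of_comp_eq [IsNoetherianRing S] {e : ℕ} (F : MvPolynomial (Fin (m + 1)) κ₀)
    (hF : F.IsHomogeneous e) (π : affineBlowup (M) ⟶ affineBlowup (M)) (hπ : π ≫ R₀ = R₀) :
    ((GeneratingSections.ofHom R₀).secOfForm F₀ F hF).zeroIdeal.comap π =
      ((GeneratingSections.ofHom R₀).secOfForm F₀ F hF).zeroIdeal := by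
  refine eq_of_forall_comap_awayι_eq y κ₀ fun i => ?_
  -- the chart and its lift of `π`
  have hr : Set.range (Proj.awayι ℛ (sElt i) (sElt_mem y κ₀ i) one_pos) =
      ((Proj.basicOpen ℛ (sElt i) : (affineBlowup (M)).Opens) : Set (affineBlowup (M))) := by
    rw [← Scheme.Hom.coe_opensRange, Proj.opensRange_awayι]
  have hmem : ∀ z : affineBlowup (M), z ∈ Proj.basicOpen ℛ (sElt i) ↔
      (R₀) z ∈ Proj.basicOpen 𝒜κ (MvPolynomial.X i) := fun z => by
    rw [← ofHom_retraction₀_U y κ₀ i, GeneratingSections.ofHom_U]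
    rfl
  have hrange : Set.range (Proj.awayι ℛ (sElt i) (sElt_mem y κ₀ i) one_pos ≫ π) ⊆
      Set.range (Proj.awayι ℛ (sElt i) (sElt_mem y κ₀ i) one_pos) := by
    rintro _ ⟨x, rfl⟩
    have hx : (Proj.awayι ℛ (sElt i) (sElt_mem y κ₀ i) one_pos) x ∈
        ((Proj.basicOpen ℛ (sElt i) : (affineBlowup (M)).Opens) : Set (affineBlowup (M))) := hr ▸ ⟨x, rfl⟩
    have h1 := (hmem _).1 hx
    rw [← hπ, Scheme.Hom.comp_apply] at h1
    have h2 := (hmem _).2 h1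
    rw [hr, Scheme.Hom.comp_apply]
    exact h2
  set θ := IsOpenImmersion.lift (Proj.awayι ℛ (sElt i) (sElt_mem y κ₀ i) one_pos)
    (Proj.awayι ℛ (sElt i) (sElt_mem y κ₀ i) one_pos ≫ π) hrange with hθdef
  have hθ : θ ≫ Proj.awayι ℛ (sElt i) (sElt_mem y κ₀ i) one_pos =
      Proj.awayι ℛ (sElt i) (sElt_mem y κ₀ i) one_pos ≫ π := IsOpenImmersion.lift_fac _ _ hrange
  rw [← Scheme.IdealSheafData.comap_comp, ← hθ, Scheme.IdealSheafData.comap_comp,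
    comap_awayι_zeroIdeal, ← Spec.map_preimage θ, comap_idealSheaf_specMap', Ideal.map_span,
    Set.image_singleton]
  congr 3
  -- the generator is `θ`-invariant: it is pulled back from `D₊(T_i)` and `θ ≫ ι' ≫ r₀ = ι' ≫ r₀`
  have hcomp : θ ≫ (Proj.awayι ℛ (sElt i) (sElt_mem y κ₀ i) one_pos ≫ R₀) =
      Proj.awayι ℛ (sElt i) (sElt_mem y κ₀ i) one_pos ≫ R₀ := by
    rw [← Category.assoc, hθ, Category.assoc, hπ]
  have e₁ : ((⊤ : (Spec (.of (Away ℛ (sElt i)))).Opens) : (Spec (.of (Away ℛ (sElt i)))).Opens) ≤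
      (Proj.awayι ℛ (sElt i) (sElt_mem y κ₀ i) one_pos ≫ R₀) ⁻¹ᵁ Proj.basicOpen 𝒜κ (MvPolynomial.X i) := by
    rw [Scheme.Hom.comp_preimage, ← GeneratingSections.ofHom_U, ofHom_retraction₀_U]
    exact top_le_preimage_of_opensRange_eq _ (Proj.opensRange_awayι ℛ (sElt i) (sElt_mem y κ₀ i) one_pos)
  have hw := appLE_awayι_retraction₀ y κ₀ i e₁
    (Away.isLocalizationElem (ProjectiveSpace.X_mem (R := κ₀) i) hF)
  -- `θ^* w' = w'`
  have hinv := congrArg (fun ψ => ψ.hom (Proj.awayToSection 𝒜κ (MvPolynomial.X i)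
      (Away.isLocalizationElem (ProjectiveSpace.X_mem (R := κ₀) i) hF)))
    (Scheme.Hom.appLE_comp_appLE θ (Proj.awayι ℛ (sElt i) (sElt_mem y κ₀ i) one_pos ≫ R₀)
      (Proj.basicOpen 𝒜κ (MvPolynomial.X i)) ⊤ ⊤ e₁ le_top)
  simp only [CommRingCat.hom_comp, RingHom.coe_comp, Function.comp_apply] at hinv
  rw [hw, appLE_apply_congr hcomp, hw] at hinv
  -- `θ = Spec (preimage θ)`: compare with `Spec(φ)^*`
  have hθtop : θ.appLE ⊤ ⊤ le_top = θ.appTop := (Scheme.Hom.app_eq_appLE _).symm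
  have hθtop' := congrArg (fun ψ => ψ.hom ((Scheme.ΓSpecIso (.of (Away ℛ (sElt i)))).inv
    (Away.map (reesPresentation y) ((mapGraded κ₀ S (Fin (m + 1))) (MvPolynomial.X i))
      (Away.map (mapGraded κ₀ S (Fin (m + 1))) (MvPolynomial.X i)
        (Away.isLocalizationElem (ProjectiveSpace.X_mem (R := κ₀) i) hF))))) hθtop
  simp only at hθtop'
  rw [hθtop'] at hinv
  have hspec := Literature.AlgebraicGeometry.Limits.FTModel.specMap_appTop_ΓSpecIso_inv (Spec.preimage θ)
    (Away.map (reesPresentation y) ((mapGraded κ₀ S (Fin (m + 1))) (MvPolynomial.X i))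
      (Away.map (mapGraded κ₀ S (Fin (m + 1))) (MvPolynomial.X i)
        (Away.isLocalizationElem (ProjectiveSpace.X_mem (R := κ₀) i) hF)))
  rw [Spec.map_preimage] at hspec
  exact (Scheme.ΓSpecIso (.of (Away ℛ (sElt i)))).commRingCatIsoToRingEquiv.symm.injective
    (hspec.symm.trans hinv)

end Chart

end DepthOne

end Summit.ResolutionOfSingularities.ResolutionOfSingularities.Theorems

end
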